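import Summits.AtomisticToContinuum.Crystallization.Theses.PerronTransitivity
import Summits.AtomisticToContinuum.Crystallization.Theorems.ChargedEnergyGap.Negative.BlocksBound
import Summits.AtomisticToContinuum.Crystallization.Theorems.PerronTransitivityTransitiveLocalLimitSuperBoundSparseOfK

/-!
# K* forces energy-transitivity of periodic minimisers

Support file for crux `PerronTransitivity.NoFractionalGain` (K*, stmt-AtomisticToContinuum-15098):
the exact NECESSARY CONDITION that the planners' kill criterion and the disprover's "exact
consequence" state in prose —

  **K* ⇒ every periodic configuration `Q` of `ℝ³` attaining `E* = ⨅_P e_LJ(P)` is ENERGY-TRANSITIVE:**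
  **every site `p ∈ Q` has lattice sum `Σ_{q ∈ Q, q ≠ p} V_LJ(|p − q|) = 2E*` exactly.**

So a certified non-transitive periodic Lennard-Jones minimiser (dhcp/4H-type: two site classes
straddling the mean) refutes K* (`not_noFractionalGain_of_siteSum_ne`), and K* is at least as strong as
"all periodic LJ ground states are energy-transitive" — strictly more than the route
`PerronTransitivity` consumes (its deciding theorem uses only `TransitiveLocalLimit`).

PROOF (blocks + the weight test).  If a motif point `x` of an `E*`-attaining `Q` had site sum
`2E* − γ`, `γ > 0`, test K* on the block `F + [0,K)³·b` (an injective finite configuration, tree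
`Blocks.blockConfig`) with the weights `c = 1 + t·1_S` of the landed finite weight test
`card_superBound_le_of_copositive` (`S` = sites bound below `2E* − γ/2`):
`#S ≤ (8(C + 2|E*|)/γ²)·(E(block) − #block·E*)`.  Blocks are trial states
(`Blocks.exists_block_energy_le`: `E(block) ≤ #block·(e(Q) + ε)` for `K ≥ K₀(ε)`), so with
`e(Q) = E*` and `ε = γ²/(16(C + 2|E*|)#F)` the right-hand side is `≤ K³/2`; but every DEEP copy of
`x` in the block is in `S` (its block site energy is the full site sum minus a tail `≥ −farSix/6`,
tree `Blocks.neg_tailSix_le_tail` / `tailSix_le_farSix` / `le_dist_of_deep`), and at most `6ρ'K²`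
lattice coordinates are not deep (`Blocks.card_not_deep_le`): `K³ − 6ρ'K² ≤ K³/2` fails for
`K > 12ρ'`.  Hence every motif site sum is `≥ 2E*`; they average to `2e(Q) = 2E*`
(`Blocks.sum_siteSum_eq`), so all equal `2E*`, and translation invariance (`Blocks.siteSum_add`)
carries this to every point of `Q`.  All `[folklore]` given K*.
-/

noncomputable section

namespace Summit.AtomisticToContinuum.Crystallization.Theorems.PerronTransitivity.NoFractionalGain

open Literature.MathematicalPhysics.StatisticalMechanics
open Summit.AtomisticToContinuum.Crystallization.Theorems.ChargedEnergyGapNegative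
open Summit.AtomisticToContinuum.Crystallization.Theorems.ChargedEnergyGapNegative.Blocks
open Summit.AtomisticToContinuum.Crystallization.Theorems.TransitiveLocalLimitBirth
  (card_superBound_le_of_copositive sum_abs_lennardJones_erase_le)
open scoped BigOperators

variable (Q : PeriodicConfiguration 3)

/-! ## Block site energies -/

/-- **Site energy of a block point**: in the block configuration, the site energy of the point
indexed by `u = (x, k)` is the full lattice sum at `x` minus the tail over points outside the
block. [folklore] -/
theorem siteEnergy_blockConfig (K : ℕ) (u : BIdx Q K) :
    siteEnergy lennardJones (blockConfig Q K) (Fintype.equivFin (BIdx Q K) u) =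
      siteSum Q lennardJones u.1 - tail Q K lennardJones u := by
  unfold siteEnergy
  rw [Finset.sum_erase_eq_sub (Finset.mem_univ _), dist_self, lennardJones_zero, sub_zero]
  simp only [blockConfig_apply, Equiv.symm_apply_apply]
  rw [Equiv.sum_comp (Fintype.equivFin (BIdx Q K)).symm
    (fun v => lennardJones (dist (bpt Q K u) (bpt Q K v)))]
  exact sum_row_eq Q K u

/-- **Deep block points are bound almost as well as in the crystal**: if the lattice
coordinates of `u = (x, k)` are `ρ'(ρ)`-deep, the block site energy at `u` is at most
`siteSum x + farSix(x, ρ)/6` (the missing terms are `≥ −r⁻⁶/6` and lie at distance `≥ ρ`).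
[folklore] -/
theorem siteEnergy_blockConfig_le_of_deep (K : ℕ) {ρ : ℝ} {u : BIdx Q K}
    (hdeep : IsDeep K (depth Q ρ) u.2) :
    siteEnergy lennardJones (blockConfig Q K) (Fintype.equivFin (BIdx Q K) u) ≤
      siteSum Q lennardJones u.1 + 1 / 6 * farSix Q u.1 ρ := by
  rw [siteEnergy_blockConfig]
  have h1 := neg_tailSix_le_tail Q K u
  have h2 : tailSix Q K u ≤ farSix Q u.1 ρ :=
    tailSix_le_farSix Q K u fun q hq => le_dist_of_deep Q K hdeep q hq
  linarith

/-- Blocks inherit the separation of the periodic configuration. [folklore] -/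
theorem blockConfig_separated (K : ℕ) {δ : ℝ}
    (hδ : ∀ s ∈ Q.points, ∀ s' ∈ Q.points, s ≠ s' → δ ≤ dist s s') :
    ∀ k l : Fin (Fintype.card (BIdx Q K)), k ≠ l →
      δ ≤ dist (blockConfig Q K k) (blockConfig Q K l) := fun k l hkl =>
  hδ (blockConfig Q K k) (bpt_mem Q K _) (blockConfig Q K l) (bpt_mem Q K _)
    ((blockConfig_injective Q K).ne hkl)

/-- **Many deep coordinates**: at least `K³ − 6ρ'K²` lattice coordinates of `[0,K)³` are
`ρ'`-deep. [folklore] -/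
theorem card_isDeep_ge_cube (K ρ' : ℕ) :
    (K : ℝ) ^ 3 - 6 * ρ' * (K : ℝ) ^ 2 ≤
      ((Finset.univ.filter fun k : Fin 3 → Fin K => IsDeep K ρ' k).card : ℝ) := by
  classical
  have hsum := Finset.card_filter_add_card_filter_not
    (s := (Finset.univ : Finset (Fin 3 → Fin K))) (fun k : Fin 3 → Fin K => IsDeep K ρ' k)
  rw [Finset.card_univ, Fintype.card_fun, Fintype.card_fin, Fintype.card_fin] at hsum
  have hnd : ((Finset.univ.filter fun k : Fin 3 → Fin K => ¬ IsDeep K ρ' k).card : ℝ) ≤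
      6 * ρ' * (K : ℝ) ^ 2 := by exact_mod_cast card_not_deep_le K ρ'
  have hsumR : ((Finset.univ.filter fun k : Fin 3 → Fin K => IsDeep K ρ' k).card : ℝ) +
      ((Finset.univ.filter fun k : Fin 3 → Fin K => ¬ IsDeep K ρ' k).card : ℝ) = (K : ℝ) ^ 3 := by
    exact_mod_cast hsum
  linarith

/-! ## No super-bound site in an `E*`-attaining periodic configuration -/

/-- **K* ⇒ no motif site of an `E*`-attaining periodic configuration is super-bound**:
`2E* ≤ Σ_{q ≠ x} V_LJ(|x − q|)` for every motif point `x` of a periodic `Q` with `e(Q) = E*`.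
[folklore] -/
theorem two_mul_eStar_le_siteSum_of_noFractionalGain
    (hK : Summit.AtomisticToContinuum.Crystallization.Theses.PerronTransitivity.NoFractionalGain)
    (hQ : Q.energyPerParticle lennardJones = eStar) {x : EuclideanSpace ℝ (Fin 3)}
    (hx : x ∈ Q.motif) :
    2 * eStar ≤ siteSum Q lennardJones x := by
  classical
  by_contra hlt
  push Not at hlt
  -- the deficit `γ > 0` of the super-bound motif site `x`
  set γ : ℝ := 2 * eStar - siteSum Q lennardJones x with hγ
  have hγ0 : 0 < γ := by rw [hγ]; linarith
  -- separation of `Q` and the absolute row-sum constant `C`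
  obtain ⟨δ, hδ, hsep⟩ := Q.exists_pos_le_dist
  set C : ℝ := (δ⁻¹ ^ 6 / 12 + 1 / 6) * (250 * δ⁻¹ ^ 6) with hC
  have hC0 : 0 < C := by positivity
  set A : ℝ := C + 2 * |eStar| with hA
  have hA0 : 0 < A := by positivity
  have hF : (0 : ℝ) < Q.motif.card := by exact_mod_cast Q.motif_nonempty.card_pos
  -- clearance `ρ` beyond which the sixth-power far part at `x` is `< 3γ`
  obtain ⟨ρ, hρ⟩ := exists_farSix_lt Q x (show 0 < 3 * γ by positivity)
  have hfar : farSix Q x ρ < 3 * γ := hρ ρ le_rfl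
  -- block size: energy tolerance `ε` and depth `ρ'`
  set ε : ℝ := γ ^ 2 / (16 * A * Q.motif.card) with hε
  have hε0 : 0 < ε := by positivity
  obtain ⟨K₀, hK₀, hblock⟩ := exists_block_energy_le Q hε0
  set ρ' : ℕ := depth Q ρ with hρ'
  set K : ℕ := max K₀ (12 * ρ' + 1) with hKdef
  have hKK₀ : K₀ ≤ K := le_max_left _ _
  have hKbig : 12 * (ρ' : ℝ) < K := by
    have : 12 * ρ' + 1 ≤ K := le_max_right _ _
    exact_mod_cast Nat.lt_of_lt_of_le (Nat.lt_succ_self _) this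
  have hKpos : (0 : ℝ) < K := by exact_mod_cast lt_of_lt_of_le hK₀ hKK₀
  -- the block as a finite configuration of `n = #F·K³` points
  set n : ℕ := Fintype.card (BIdx Q K) with hn
  have hnR : (n : ℝ) = Q.motif.card * (K : ℝ) ^ 3 := by
    rw [hn]; exact_mod_cast card_BIdx Q K
  set y : Fin n → EuclideanSpace ℝ (Fin 3) := blockConfig Q K with hy
  -- K* on the block = the copositive inequality at level `E*`
  have hcop : ∀ c : Fin n → ℝ, (∀ i, 0 ≤ c i) → 2 * eStar * ∑ i, c i ^ 2 ≤
      ∑ i, ∑ j ∈ Finset.univ.erase i, c i * c j * lennardJones (dist (y i) (y j)) :=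
    fun c hc => hK n y (blockConfig_injective Q K) c hc
  -- the finite weight test with `θ = γ/2`
  set S := Finset.univ.filter fun i : Fin n => siteEnergy lennardJones y i ≤ 2 * eStar - γ / 2
    with hS
  have hcard : (S.card : ℝ) ≤
      2 * (C + 2 * |eStar|) / (γ / 2) ^ 2 * (interactionEnergy lennardJones y - n * eStar) :=
    card_superBound_le_of_copositive y hC0
      (fun i => sum_abs_lennardJones_erase_le y hδ (blockConfig_separated Q K hsep) i)
      (half_pos hγ0) hcop
  -- upper bound: blocks are trial states, `E(block) − n·E* ≤ n·ε`, so `#S ≤ K³/2`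
  have hE : interactionEnergy lennardJones y - n * eStar ≤ n * ε := by
    have h : interactionEnergy lennardJones y ≤ (n : ℝ) * (eStar + ε) := by
      have := hblock K hKK₀
      rw [hQ] at this
      exact this
    rw [mul_add] at h
    linarith
  have hupper : (S.card : ℝ) ≤ (K : ℝ) ^ 3 / 2 := by
    have h1 : 2 * (C + 2 * |eStar|) / (γ / 2) ^ 2 * (interactionEnergy lennardJones y - n * eStar) ≤
        2 * (C + 2 * |eStar|) / (γ / 2) ^ 2 * (n * ε) :=
      mul_le_mul_of_nonneg_left hE (by positivity)
    have h2 : 2 * (C + 2 * |eStar|) / (γ / 2) ^ 2 * (n * ε) = (K : ℝ) ^ 3 / 2 := by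
      rw [hnR, hε, ← hA]
      field_simp
      ring
    linarith
  -- lower bound: every deep copy of `x` lies in `S`
  set D := Finset.univ.filter fun k : Fin 3 → Fin K => IsDeep K ρ' k with hD
  have hxF : (⟨x, hx⟩ : Q.motif) = ⟨x, hx⟩ := rfl
  set ι : (Fin 3 → Fin K) → Fin n := fun k => Fintype.equivFin (BIdx Q K) (⟨x, hx⟩, k) with hι
  have hιinj : Function.Injective ι := by
    intro k k' h
    have := (Fintype.equivFin (BIdx Q K)).injective h
    exact (Prod.ext_iff.1 this).2
  have hmem : ∀ k ∈ D, ι k ∈ S := by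
    intro k hk
    rw [hD, Finset.mem_filter] at hk
    rw [hS, Finset.mem_filter]
    refine ⟨Finset.mem_univ _, ?_⟩
    have h := siteEnergy_blockConfig_le_of_deep Q K (u := (⟨x, hx⟩, k)) hk.2
    have : siteSum Q lennardJones x + 1 / 6 * farSix Q x ρ ≤ 2 * eStar - γ / 2 := by
      rw [hγ]; linarith
    exact h.trans this
  have hlower : (D.card : ℝ) ≤ S.card := by
    have : D.card ≤ S.card :=
      Finset.card_le_card_of_injOn ι hmem (hιinj.injOn)
    exact_mod_cast this
  have hdeep : (K : ℝ) ^ 3 - 6 * ρ' * (K : ℝ) ^ 2 ≤ D.card := card_isDeep_ge_cube K ρ'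
  -- contradiction: `K³ − 6ρ'K² ≤ K³/2` forces `K ≤ 12ρ'`
  have h1 : (K : ℝ) ^ 3 / 2 ≤ 6 * ρ' * (K : ℝ) ^ 2 := by linarith
  have h2 : (K : ℝ) ≤ 12 * ρ' := by
    have hK2 : (0 : ℝ) < (K : ℝ) ^ 2 := by positivity
    have : (K : ℝ) * (K : ℝ) ^ 2 ≤ (12 * ρ') * (K : ℝ) ^ 2 := by nlinarith
    exact le_of_mul_le_mul_right this hK2
  linarith

/-! ## Energy-transitivity of `E*`-attaining periodic configurations -/

/-- **K* ⇒ every motif site of an `E*`-attaining periodic configuration has lattice sum exactly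
`2E*`** (all are `≥ 2E*` and they average to `2e(Q) = 2E*`). [folklore] -/
theorem siteSum_eq_two_mul_eStar_of_noFractionalGain
    (hK : Summit.AtomisticToContinuum.Crystallization.Theses.PerronTransitivity.NoFractionalGain)
    (hQ : Q.energyPerParticle lennardJones = eStar) {x : EuclideanSpace ℝ (Fin 3)}
    (hx : x ∈ Q.motif) :
    siteSum Q lennardJones x = 2 * eStar := by
  have hge : ∀ z ∈ Q.motif, 2 * eStar ≤ siteSum Q lennardJones z := fun z hz =>
    two_mul_eStar_le_siteSum_of_noFractionalGain Q hK hQ hz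
  have hsum : ∑ z ∈ Q.motif, (siteSum Q lennardJones z - 2 * eStar) = 0 := by
    rw [Finset.sum_sub_distrib, sum_siteSum_eq, hQ, Finset.sum_const, nsmul_eq_mul]
    ring
  have hzero := (Finset.sum_eq_zero_iff_of_nonneg fun z hz => sub_nonneg.2 (hge z hz)).1 hsum x hx
  linarith

/-- The same at EVERY point of the configuration (translation invariance of lattice sums).
[folklore] -/
theorem siteSum_eq_two_mul_eStar_of_noFractionalGain_of_mem_points
    (hK : Summit.AtomisticToContinuum.Crystallization.Theses.PerronTransitivity.NoFractionalGain)
    (hQ : Q.energyPerParticle lennardJones = eStar) {p : EuclideanSpace ℝ (Fin 3)}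
    (hp : p ∈ Q.points) :
    siteSum Q lennardJones p = 2 * eStar := by
  obtain ⟨y, hy, g, hg, rfl⟩ := hp
  rw [siteSum_add Q lennardJones hg y]
  exact siteSum_eq_two_mul_eStar_of_noFractionalGain Q hK hQ hy

/-- **K* ⇒ periodic Lennard-Jones minimisers are energy-transitive** (route vocabulary): under
`NoFractionalGain`, if a periodic configuration `Q` of `ℝ³` is LEAST in energy per particle among
periodic configurations, then every site `p ∈ Q` has lattice sum
`Σ'_{q ∈ Q, q ≠ p} V_LJ(dist p q) = 2·⨅_P e_LJ(P)` — the level of the cruxes `UniformBindingRigidity`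
and `TransitiveLocalLimit`. [folklore] -/
theorem periodicMinimiser_transitive_of_noFractionalGain : Summit.AtomisticToContinuum.Crystallization.Theses.PerronTransitivity.NoFractionalGain → ∀ (Q : PeriodicConfiguration 3), IsLeast (Set.range fun P : PeriodicConfiguration 3 => P.energyPerParticle lennardJones) (Q.energyPerParticle lennardJones) → ∀ (p : EuclideanSpace ℝ (Fin 3)), p ∈ Q.points → ∑' q : {q : EuclideanSpace ℝ (Fin 3) // q ∈ Q.points ∧ q ≠ p}, lennardJones (dist p q.1) = 2 * ⨅ P : PeriodicConfiguration 3, P.energyPerParticle lennardJones := by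
  intro hK Q hQ p hp
  have he : Q.energyPerParticle lennardJones = eStar := (hQ.csInf_eq).symm
  exact siteSum_eq_two_mul_eStar_of_noFractionalGain_of_mem_points Q hK he hp

/-- **Kill criterion made formal**: a periodic Lennard-Jones minimiser with two sites of
different lattice sums (a NON-energy-transitive minimiser, e.g. of dhcp/4H type) refutes K*.
[folklore] -/
theorem not_noFractionalGain_of_siteSum_ne (Q : PeriodicConfiguration 3)
    (hQ : IsLeast (Set.range fun P : PeriodicConfiguration 3 => P.energyPerParticle lennardJones)
      (Q.energyPerParticle lennardJones))
    {p q : EuclideanSpace ℝ (Fin 3)} (hp : p ∈ Q.points) (hq : q ∈ Q.points)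
    (hne : siteSum Q lennardJones p ≠ siteSum Q lennardJones q) :
    ¬ Summit.AtomisticToContinuum.Crystallization.Theses.PerronTransitivity.NoFractionalGain := by
  intro hK
  have he : Q.energyPerParticle lennardJones = eStar := (hQ.csInf_eq).symm
  exact hne ((siteSum_eq_two_mul_eStar_of_noFractionalGain_of_mem_points Q hK he hp).trans
    (siteSum_eq_two_mul_eStar_of_noFractionalGain_of_mem_points Q hK he hq).symm)

/-- **Equivalently: under K*, a super-bound or sub-bound site certifies non-minimality** — if some
site of a periodic `Q` has lattice sum `≠ 2E*`, then `e(Q) > E*`. [folklore] -/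
theorem eStar_lt_energyPerParticle_of_siteSum_ne
    (hK : Summit.AtomisticToContinuum.Crystallization.Theses.PerronTransitivity.NoFractionalGain)
    (Q : PeriodicConfiguration 3) {p : EuclideanSpace ℝ (Fin 3)} (hp : p ∈ Q.points)
    (hne : siteSum Q lennardJones p ≠ 2 * eStar) :
    eStar < Q.energyPerParticle lennardJones := by
  refine lt_of_le_of_ne (eStar_le Q) fun he => hne ?_
  exact siteSum_eq_two_mul_eStar_of_noFractionalGain_of_mem_points Q hK he.symm hp

end Summit.AtomisticToContinuum.Crystallization.Theorems.PerronTransitivity.NoFractionalGain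

end
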